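import Summits.HodgeConjecture.HodgeConjecture.Theorems.Ring2ClassTargetsRows
import Summits.HodgeConjecture.HodgeConjecture.Theorems.WeilTypeLadderSixfoldsOnPath
import Summits.HodgeConjecture.HodgeConjecture.Theorems.SevenfoldWeilCensusAssembly
import Literature.AlgebraicGeometry.HodgeTheory.AlgebraicClassesCupAbelianVariety
import HarnessLib

/-!
# Ring 2 around `HC_CM` — atlas ROWS `6, 7` in the kernel: the census OFF a settled class (typer 1)

HONEST FRAMING (page 1, verbatim in every file of this cell): research route conditional on HC_CM; not a
corollary; Q11.4-sentence-2 already refuted in dim ≥ 3.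

`HC_CM` := `Theses.RankFourFaces.CMAbelianHodge` (item stmt-HodgeConjecture-3052) is OPEN and occurs below only
as a HYPOTHESIS, by name (§S3). `HC_AV` (stmt-1333), `WeilSixfolds` (stmt-2524, the cell `W₆`), the census cruxes
`CodimTwoFromLowerDim` (X2, stmt-18721) and `CodimThreeWeilGeneration` (X1, stmt-18720) of route
`SevenfoldWeilCensus`, and the LADDER nodes `WeilTypeLadder.AbelianSixfolds` (R6) / `AbelianDimLeSeven` (R7) are
OPEN items / conjecture nodes of the tree, used BY NAME as hypotheses or conclusions, never asserted. No new
named fact, no `sorry`, no new definition.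

WHY THIS FILE (sequel to `Ring2ClassTargets` / `Ring2ClassTargetsRows`, same namespace). Rows `4, 5` are typed there
(`HCUpToDim 5 ↔` the Weil-fourfold cell `W₄` modulo Moonen–Zarhin Thms. 0.1–0.2); rows `6, 7` were left as
`HCAtDim 6 ∧ HC(non-simple sevenfolds)`. Their only reduction in the tree is the PROVED assembly of route
`SevenfoldWeilCensus` (X2 → X1 → W₆ → floor → HC in dim `≤ 7`), whose leg X2 is REFUTED AT EVIDENCE LEVEL
(2026-08-18, hodge-weil LADDER, STATUS UPDATE in `Theorems/WeilTypeLadderSixfolds.lean`, jobs j038435 / j038496;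
kernel census `Literature.AlgebraicGeometry.HodgeTheory.PohlmannSetsZeta24ProductSixfold.card_hodgeSets_i_m3`,
p176557): on the CM sixfold `B × E′ × E″` (`B` of CM type `(ℚ(ζ₂₄), {σ₁,σ₅,σ₇,σ₁₃})`) `dim B² = 19 = 15 + 4`, only
`15` from `D²` and quotients of dimension `< 6`; all `38` violating configurations are PRODUCTS of CM abelian
varieties (patterns `(4,1,1)`, `(4,2)`, `(2,2,2)`), all `280` simple CM sixfold configurations conform, X1 conforms
throughout; the item stays formally `open` (a Lean `¬ X2` needs a CM constructor). Every violator of THAT census is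
of CM type (products of CM abelian varieties are CM, Milne 1999 §2; a CM-type census — Pohlmann 1968 Thm. 1 — sees
no non-CM variety), i.e. lies in the one class on which the cell's standing hypothesis `HC_CM` gives HC outright.
NOT SO the cell's own NEW ROW (atlas-2, `Theorems/Ring2AtlasSixfolds.lean`, p191466, 2026-08-19; engine-B inference,
one implementation, NOT in print): `Y × Z`, `Y` a simple NON-CM fourfold with `End⁰` a quartic CM field of signature
`{(2,0),(1,1)}`, `Z` its K3-partner CM surface, carries `4` exceptional `(2,2)`-classes in `H²(Y) ⊗ H²(Z)` not
pulled back from dimension `< 6` (typed claim `Ring2.Atlas.QuarticTypeIVFourfoldCMSurfaceSpanFailure`) — a candidate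
violator of X2 OUTSIDE the CM locus, which `HC_CM` does NOT absorb. The theorems below are therefore stated for an
ARBITRARY settled class `𝒞` and for `𝒞 = CM ∪ 𝒦` (§S2): they isolate exactly which cells of rows `6, 7` must be
granted for the census mechanism to carry the rest.

WHAT THIS FILE PROVES. Fix any class `𝒞` of complex abelian varieties on which HC is granted (`HCOnClass 𝒞`;
the cell's case is `𝒞 = IsOfCMType` under `HC_CM`, `hcOnClass_cmType_of_hcCM`). Then the sevenfold reduction
goes through with the census cruxes and the Weil-sixfold cell demanded only OFF `𝒞`:
* §S1 (`hcUpToDim_seven_of_censusOff`): `HCOnClass 𝒞`, X2 off `𝒞`, X1 off `𝒞`, Weil classes of the sixfolds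
  off `𝒞` and the floor `HCUpToDim 5` give `HCUpToDim 7` (the assembly's strong induction with the extra case
  split `𝒞 A`); hence, modulo {`HCOnClass 𝒞`, census off `𝒞`, floor}, rows `≤ 7` are EXACTLY the Weil classes of
  the sixfolds OUTSIDE `𝒞` (`hcUpToDim_seven_iff_weilSixfoldsOff_of_censusOff`), equivalently the cell `W₆`,
  equivalently row `6` alone (`…_iff_weilSixfolds_…`, `…_iff_hcAtDim_six_…`: row `7` has NO cell of its own), and —
  adding Moonen–Zarhin Thms. 0.1–0.2 — EXACTLY the two Weil cells `W₄ ∧ W₆` (`hcUpToDim_seven_iff_weilCells_of_censusOff`).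
  For `𝒞 = ⊥` the hypotheses are the route items verbatim (the frame's `hcUpToDim_seven_of_sevenfoldWeilCensus`).
* §S2 `𝒞 = IsOfCMType`: UNDER `HC_CM` (binder by name) rows `≤ 7` are exactly the Weil classes of the NON-CM
  Weil-type sixfolds, modulo the census OFF THE CM LOCUS and the floor
  (`hcUpToDim_seven_iff_nonCMWeilSixfolds_of_hcCM`): `HC_CM` absorbs every violator of the CM census, but NOT
  atlas-2's non-CM row `Y × Z`; with `𝒞 = CM ∪ 𝒦` for any further granted cell `𝒦` (e.g. that row, as the
  hypothesis `HCOnClass 𝒦`; `hcUpToDim_seven_iff_weilSixfoldsOff_of_hcCM_of_hcOnClass`) the census is demanded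
  only off `CM ∪ 𝒦`. This is where `HC_CM` is, and is not, load-bearing in rows `6, 7` (RING2-MAP (c7)).
* §S0 cross-links BY NAME to the hodge-weil LADDER (R6 `↔ HCAtDim 6`, R7 `↔ HCUpToDim 7`, on-path `HCAtDim 6 → W₆
  → (W₆ off 𝒞)`); §S3 audit: every HC-shaped statement here follows from `HodgeConjecture` (the census hypotheses
  are Hodge-theoretic classification statements, NOT consequences of HC, and are never asserted).

References (bib keys): MoonenZarhin1999LowDim (Thms. 0.1–0.2, (2.7)–(2.8), §5; arXiv:math/9901113), MoonenZarhin1995Duke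
((g)), Pohlmann1968 (Thm. 1), GaoUllmo2025 (Thm. 3.1), Markman2025SecantWeil = arXiv:2502.03415 (Cor. 1.6.1, Thm. 1.5.1;
UNREFEREED), Schoen1988HodgeWeil, vanGeemen1994HodgeAV (§7.4), Deligne1982HodgeCycles (§5), Milne1999 (§7 (H)),
VoisinHodgeI2002 (Thms. 6.25, 11.30), Deligne2000 (§1).
-/

set_option linter.dupNamespace false

noncomputable section

open CategoryTheory
open Literature.AlgebraicGeometry Literature.AlgebraicGeometry.Motives
open Literature.AlgebraicGeometry.HodgeTheory
open Literature.AlgebraicGeometry.Milne1999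
open Literature.AlgebraicTopology.SingularHomology
open Literature.Barriers.HodgeConjecture

namespace Summit.HodgeConjecture.HodgeConjecture.Ring2.ClassTargets

/-! ## §S0 Cross-links by name: LADDER R6 = row `6`, R7 = rows `≤ 7`; the on-path arrows into the cell `W₆` -/

/-- **LADDER R6 is the frame's row `6`**: `WeilTypeLadder.AbelianSixfolds ↔ HCAtDim 6` (guard provable). [folklore] [cite: Deligne2000, §1] -/
theorem abelianSixfolds_iff_hcAtDim_six : WeilTypeLadder.AbelianSixfolds ↔ HCAtDim 6 :=
  (hcOnClass_iff_guarded fun A ↦ A.dim = 6).symm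

/-- **LADDER R7 is the frame's rows `≤ 7`**: `WeilTypeLadder.AbelianDimLeSeven ↔ HCUpToDim 7`. [folklore] [cite: Deligne2000, §1] -/
theorem abelianDimLeSeven_iff_hcUpToDim_seven : WeilTypeLadder.AbelianDimLeSeven ↔ HCUpToDim 7 :=
  (hcOnClass_iff_guarded fun A ↦ A.dim ≤ 7).symm

/-- **ON-PATH for the cell `W₆`**: row `6` gives the shared crux `WeilSixfolds` (stmt-HodgeConjecture-2524; LADDER
`weilSixfolds_of_abelianSixfolds` on the frame's axis). [cite: Deligne2000, §1] [cite: Markman2025SecantWeil, Thm. 1.5.1] -/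
theorem weilSixfolds_of_hcAtDim_six (h : HCAtDim 6) : Theses.SevenfoldWeilCensus.WeilSixfolds :=
  WeilTypeLadder.weilSixfolds_of_abelianSixfolds (abelianSixfolds_iff_hcAtDim_six.mpr h)

/-- ON-PATH: rows `≤ 7` give the cell `W₆`. [cite: Deligne2000, §1] -/
theorem weilSixfolds_of_hcUpToDim_seven (h : HCUpToDim 7) : Theses.SevenfoldWeilCensus.WeilSixfolds :=
  weilSixfolds_of_hcAtDim_six (hcAtDim_mono (by norm_num) (hcAtDim_of_hcUpToDim h))

/-- **The cell `W₆` gives its restriction OFF any class `𝒞`**, in the Weil-plane spelling X1 consumes (`w ∈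
weilClassesOf B ψ 3 d`; eigen-splitting = `Submodule.mem_sup`, `Theorems.sevenfoldWeilCensus_weilClass_mem_algebraicClasses`).
[cite: Markman2025SecantWeil, Thm. 1.5.1] [cite: vanGeemen1994HodgeAV, §7.4] -/
theorem weilSixfoldsOff_of_weilSixfolds (𝒞 : AbelianVariety ℂ → Prop)
    (h₄ : Theses.SevenfoldWeilCensus.WeilSixfolds) :
    ∀ (d : ℕ), 0 < d → ∀ (B : AbelianVariety ℂ) (ψ : B ⟶ B), B.dim = 6 → ψ ≫ ψ = -(d • 𝟙 B) → ¬ 𝒞 B →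
      ∀ w : complexBetti B.X (2 * 3), IsRationalClass w → IsOfHodgeType B.dim B.X (2 * 3) 3 3 w →
        w ∈ weilClassesOf B ψ 3 d → w ∈ algebraicClasses B.X 3 :=
  fun _ hd _ _ hB hψ _ _ hw hwt hweil ↦
    Theorems.sevenfoldWeilCensus_weilClass_mem_algebraicClasses h₄ hB hd hψ hw hwt hweil

/-- ON-PATH: row `6` gives the Weil classes of the sixfolds off any class `𝒞`. [cite: Deligne2000, §1] -/
theorem weilSixfoldsOff_of_hcAtDim_six (𝒞 : AbelianVariety ℂ → Prop) (h : HCAtDim 6) :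
    ∀ (d : ℕ), 0 < d → ∀ (B : AbelianVariety ℂ) (ψ : B ⟶ B), B.dim = 6 → ψ ≫ ψ = -(d • 𝟙 B) → ¬ 𝒞 B →
      ∀ w : complexBetti B.X (2 * 3), IsRationalClass w → IsOfHodgeType B.dim B.X (2 * 3) 3 3 w →
        w ∈ weilClassesOf B ψ 3 d → w ∈ algebraicClasses B.X 3 :=
  weilSixfoldsOff_of_weilSixfolds 𝒞 (weilSixfolds_of_hcAtDim_six h)

/-! ## §S1 The sevenfold reduction with the census and the cell demanded only OFF a settled class `𝒞` -/

section CensusOff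

variable {𝒞 : AbelianVariety ℂ → Prop} (h𝒞 : HCOnClass 𝒞)
  /- X2 OFF `𝒞`: the body of `Theses.SevenfoldWeilCensus.CodimTwoFromLowerDim` (stmt-18721), demanded only for
  the six- and sevenfolds outside `𝒞`. -/
  (h₃ : ∀ A : AbelianVariety ℂ, A.dim = 6 ∨ A.dim = 7 → ¬ 𝒞 A → ∀ c : complexBetti A.X (2 * 2),
    IsRationalClass c → IsOfHodgeType A.dim A.X (2 * 2) 2 2 c →
      c ∈ divisorClassesSpan A.X A.dim 2 ⊔ Submodule.span ℂ {w' : complexBetti A.X (2 * 2) |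
        ∃ (C : AbelianVariety ℂ) (g : A.X ⟶ C.X) (w : complexBetti C.X (2 * 2)), C.dim < A.dim ∧
          IsRationalClass w ∧ IsOfHodgeType C.dim C.X (2 * 2) 2 2 w ∧ w' = complexBetti.map g (2 * 2) w})
  /- X1 OFF `𝒞`: the body of `Theses.SevenfoldWeilCensus.CodimThreeWeilGeneration` (stmt-18720), idem. -/
  (h₂ : ∀ A : AbelianVariety ℂ, A.dim = 6 ∨ A.dim = 7 → ¬ 𝒞 A → ∀ c : complexBetti A.X (2 * 3),
    IsRationalClass c → IsOfHodgeType A.dim A.X (2 * 3) 3 3 c →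
      c ∈ divisorClassesSpan A.X A.dim 3 ⊔ Submodule.span ℂ {w' : complexBetti A.X (2 * 3) |
          ∃ (a : complexBetti A.X (2 * 2)) (b : complexBetti A.X (2 * 1)),
            IsRationalClass a ∧ IsOfHodgeType A.dim A.X (2 * 2) 2 2 a ∧ IsRationalClass b ∧
            IsOfHodgeType A.dim A.X (2 * 1) 1 1 b ∧ w' = cupProduct (two_mul_add_two_mul 2 1) a b} ⊔
        Submodule.span ℂ {w' : complexBetti A.X (2 * 3) |
          ∃ (C : AbelianVariety ℂ) (g : A.X ⟶ C.X) (w : complexBetti C.X (2 * 3)), C.dim < A.dim ∧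
            IsRationalClass w ∧ IsOfHodgeType C.dim C.X (2 * 3) 3 3 w ∧ w' = complexBetti.map g (2 * 3) w} ⊔
        Submodule.span ℂ {w' : complexBetti A.X (2 * 3) |
          ∃ (B : AbelianVariety ℂ) (g : A.X ⟶ B.X) (d : ℕ) (ψ : B ⟶ B) (w : complexBetti B.X (2 * 3)),
            B.dim = 6 ∧ 0 < d ∧ ψ ≫ ψ = -(d • 𝟙 B) ∧ IsRationalClass w ∧
            IsOfHodgeType B.dim B.X (2 * 3) 3 3 w ∧ w ∈ weilClassesOf B ψ 3 d ∧
            w' = complexBetti.map g (2 * 3) w})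
  /- the cell `W₆` OFF `𝒞`, Weil-plane spelling -/
  (h₄ : ∀ (d : ℕ), 0 < d → ∀ (B : AbelianVariety ℂ) (ψ : B ⟶ B), B.dim = 6 → ψ ≫ ψ = -(d • 𝟙 B) → ¬ 𝒞 B →
    ∀ w : complexBetti B.X (2 * 3), IsRationalClass w → IsOfHodgeType B.dim B.X (2 * 3) 3 3 w →
      w ∈ weilClassesOf B ψ 3 d → w ∈ algebraicClasses B.X 3)
  (h₅ : HCUpToDim 5)

include h𝒞 h₃ h₂ h₄ h₅

/-- **The cycle part of HC in dimension `≤ 7` from: HC on `𝒞`, the census OFF `𝒞`, the cell `W₆` OFF `𝒞`, the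
floor `HCUpToDim 5`.** Strong induction on `dim A` as in `Theorems.sevenfoldWeilCensus_mem_algebraicClasses_of_dim_le_seven`
with one more case split (`dim A ≤ 5`: floor; `𝒞 A`: `HCOnClass 𝒞`; else `dim A ∈ {6, 7}`: hard Lefschetz above the
middle, `p = 0` trivial, `p = 1` Lefschetz `(1,1)`, `p = 2` X2 off `𝒞` with divisor monomials and lower-dimensional
pull-backs algebraic (`AbelianVariety.divisorClassesSpan_le_algebraicClasses`, induction,
`map_mem_algebraicClasses_of_abelianVariety`), `p = 3` X1 off `𝒞` with `(2,2)·(1,1)` by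
`AbelianVariety.cupProduct_mem_algebraicClasses_one` and a Weil class of a sixfold `B` by `HCOnClass 𝒞` if `𝒞 B`, else
by `W₆` off `𝒞`). [cite: MoonenZarhin1999LowDim, (2.7)–(2.8) and §5; arXiv:math/9901113] [cite: VoisinHodgeI2002, Thms. 6.25, 11.30] -/
theorem mem_algebraicClasses_of_dim_le_seven_of_censusOff :
    ∀ (n : ℕ) (A : AbelianVariety ℂ), A.dim = n → n ≤ 7 →
      ∀ (p : ℕ) (c : complexBetti A.X (2 * p)), IsRationalClass c →
        IsOfHodgeType A.dim A.X (2 * p) p p c → c ∈ algebraicClasses A.X p := by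
  intro n
  induction n using Nat.strong_induction_on with
  | _ n ih =>
  intro A hAn hn7
  have hX : IsSmoothProjective A.dim A.X := AbelianVariety.isSmoothProjective_holds
  by_cases h5 : A.dim ≤ 5
  · exact fun p c hc hct ↦ (h₅ A h5).2 p c hc hct
  by_cases hA𝒞 : 𝒞 A
  · exact fun p c hc hct ↦ (h𝒞 A hA𝒞).2 p c hc hct
  have h67 : A.dim = 6 ∨ A.dim = 7 := by omega
  -- Lefschetz `(1,1)` on `A`
  have h11 : ∀ b : complexBetti A.X (2 * 1), IsRationalClass b →
      IsOfHodgeType A.dim A.X (2 * 1) 1 1 b → b ∈ algebraicClasses A.X 1 :=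
    fun b hb hbt ↦ lefschetzOneOne_rational_holds hX b hb hbt
  -- pull-backs of rational `(q,q)`-classes of lower-dimensional abelian varieties are algebraic (induction)
  have hpull : ∀ (q : ℕ) (C : AbelianVariety ℂ) (g : A.X ⟶ C.X) (w : complexBetti C.X (2 * q)),
      C.dim < A.dim → IsRationalClass w → IsOfHodgeType C.dim C.X (2 * q) q q w →
        complexBetti.map g (2 * q) w ∈ algebraicClasses A.X q := by
    intro q C g w hC hw hwt
    have hwC : w ∈ algebraicClasses C.X q := ih C.dim (by omega) C rfl (by omega) q w hw hwt
    exact map_mem_algebraicClasses_of_abelianVariety hX C g hwC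
  -- codimension `2`: X2 off `𝒞`
  have hp2 : ∀ c : complexBetti A.X (2 * 2), IsRationalClass c →
      IsOfHodgeType A.dim A.X (2 * 2) 2 2 c → c ∈ algebraicClasses A.X 2 := by
    intro c hc hct
    have hle : divisorClassesSpan A.X A.dim 2 ⊔ Submodule.span ℂ {w' : complexBetti A.X (2 * 2) |
        ∃ (C : AbelianVariety ℂ) (g : A.X ⟶ C.X) (w : complexBetti C.X (2 * 2)), C.dim < A.dim ∧
          IsRationalClass w ∧ IsOfHodgeType C.dim C.X (2 * 2) 2 2 w ∧
          w' = complexBetti.map g (2 * 2) w} ≤ algebraicClasses A.X 2 := by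
      refine sup_le (AbelianVariety.divisorClassesSpan_le_algebraicClasses A h11 2) (Submodule.span_le.mpr ?_)
      rintro _ ⟨C, g, w, hC, hw, hwt, rfl⟩
      exact hpull 2 C g w hC hw hwt
    exact hle (h₃ A h67 hA𝒞 c hc hct)
  -- codimension `3`: X1 off `𝒞`
  have hp3 : ∀ c : complexBetti A.X (2 * 3), IsRationalClass c →
      IsOfHodgeType A.dim A.X (2 * 3) 3 3 c → c ∈ algebraicClasses A.X 3 := by
    intro c hc hct
    have hcup : Submodule.span ℂ {w' : complexBetti A.X (2 * 3) |
        ∃ (a : complexBetti A.X (2 * 2)) (b : complexBetti A.X (2 * 1)),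
          IsRationalClass a ∧ IsOfHodgeType A.dim A.X (2 * 2) 2 2 a ∧ IsRationalClass b ∧
          IsOfHodgeType A.dim A.X (2 * 1) 1 1 b ∧
          w' = cupProduct (two_mul_add_two_mul 2 1) a b} ≤ algebraicClasses A.X 3 := by
      refine Submodule.span_le.mpr ?_
      rintro _ ⟨a, b, ha, hat, hb, hbt, rfl⟩
      exact AbelianVariety.cupProduct_mem_algebraicClasses_one A (hp2 a ha hat) (h11 b hb hbt)
    have hlow3 : Submodule.span ℂ {w' : complexBetti A.X (2 * 3) |
        ∃ (C : AbelianVariety ℂ) (g : A.X ⟶ C.X) (w : complexBetti C.X (2 * 3)), C.dim < A.dim ∧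
          IsRationalClass w ∧ IsOfHodgeType C.dim C.X (2 * 3) 3 3 w ∧
          w' = complexBetti.map g (2 * 3) w} ≤ algebraicClasses A.X 3 := by
      refine Submodule.span_le.mpr ?_
      rintro _ ⟨C, g, w, hC, hw, hwt, rfl⟩
      exact hpull 3 C g w hC hw hwt
    have hweil3 : Submodule.span ℂ {w' : complexBetti A.X (2 * 3) |
        ∃ (B : AbelianVariety ℂ) (g : A.X ⟶ B.X) (d : ℕ) (ψ : B ⟶ B) (w : complexBetti B.X (2 * 3)),
          B.dim = 6 ∧ 0 < d ∧ ψ ≫ ψ = -(d • 𝟙 B) ∧ IsRationalClass w ∧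
          IsOfHodgeType B.dim B.X (2 * 3) 3 3 w ∧ w ∈ weilClassesOf B ψ 3 d ∧
          w' = complexBetti.map g (2 * 3) w} ≤ algebraicClasses A.X 3 := by
      refine Submodule.span_le.mpr ?_
      rintro _ ⟨B, g, d, ψ, w, hB, hd, hψ, hw, hwt, hweil, rfl⟩
      refine map_mem_algebraicClasses_of_abelianVariety hX B g ?_
      by_cases hB𝒞 : 𝒞 B
      · exact (h𝒞 B hB𝒞).2 3 w hw hwt
      · exact h₄ d hd B ψ hB hψ hB𝒞 w hw hwt hweil
    exact (sup_le (sup_le (sup_le (AbelianVariety.divisorClassesSpan_le_algebraicClasses A h11 3)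
      hcup) hlow3) hweil3) (h₂ A h67 hA𝒞 c hc hct)
  have hlow : ∀ p : ℕ, 2 * p ≤ A.dim → ∀ c : complexBetti A.X (2 * p), IsRationalClass c →
      IsOfHodgeType A.dim A.X (2 * p) p p c → c ∈ algebraicClasses A.X p := by
    intro p hp c hc hct
    have hp3' : p ≤ 3 := by omega
    interval_cases p
    · exact hodgeConjectureFor_codim_zero c
    · exact h11 c hc hct
    · exact hp2 c hc hct
    · exact hp3 c hc hct
  intro p c hc hct
  by_cases hp : 2 * p ≤ A.dim
  · exact hlow p hp c hc hct
  · exact mem_algebraicClasses_of_lt_of_nonempty (nonempty_hardLefschetzNFold_holds A.dim A.X) hX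
      (by omega) (hlow (A.dim - p) (by omega)) c hc hct

/-- **Rows `≤ 7` from: HC on `𝒞`, the census OFF `𝒞`, the cell `W₆` OFF `𝒞`, the floor** (`nonempty_hodgeModel_holds`);
for `𝒞 = ⊥` the frame's `hcUpToDim_seven_of_sevenfoldWeilCensus`, unfolded. [cite: MoonenZarhin1999LowDim, (2.7)–(2.8), §5] -/
theorem hcUpToDim_seven_of_censusOff : HCUpToDim 7 := fun A hA ↦
  ⟨nonempty_hodgeModel_holds AbelianVariety.isSmoothProjective_holds,
    mem_algebraicClasses_of_dim_le_seven_of_censusOff h𝒞 h₃ h₂ h₄ h₅ A.dim A rfl hA⟩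

/-- Row `6` from the same inputs. [cite: MoonenZarhin1999LowDim, §5; arXiv:math/9901113] -/
theorem hcAtDim_six_of_censusOff : HCAtDim 6 :=
  hcAtDim_mono (by norm_num) (hcAtDim_of_hcUpToDim (hcUpToDim_seven_of_censusOff h𝒞 h₃ h₂ h₄ h₅))
/-- Row `7` from the same inputs. [cite: MoonenZarhin1999LowDim, (2.7); arXiv:math/9901113] -/
theorem hcAtDim_seven_of_censusOff : HCAtDim 7 :=
  hcAtDim_of_hcUpToDim (hcUpToDim_seven_of_censusOff h𝒞 h₃ h₂ h₄ h₅)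

omit h₄ in
/-- **EXACTNESS, sharpest form: modulo {HC on `𝒞`, census off `𝒞`, floor}, rows `≤ 7` are EXACTLY the Weil classes
of the Weil-type sixfolds OUTSIDE `𝒞`** (`→` is on-path). [cite: Markman2025SecantWeil, Thm. 1.5.1] [cite: MoonenZarhin1999LowDim, §5] -/
theorem hcUpToDim_seven_iff_weilSixfoldsOff_of_censusOff :
    HCUpToDim 7 ↔
      ∀ (d : ℕ), 0 < d → ∀ (B : AbelianVariety ℂ) (ψ : B ⟶ B), B.dim = 6 → ψ ≫ ψ = -(d • 𝟙 B) → ¬ 𝒞 B →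
        ∀ w : complexBetti B.X (2 * 3), IsRationalClass w → IsOfHodgeType B.dim B.X (2 * 3) 3 3 w →
          w ∈ weilClassesOf B ψ 3 d → w ∈ algebraicClasses B.X 3 :=
  ⟨fun h ↦ weilSixfoldsOff_of_hcAtDim_six 𝒞 (hcAtDim_mono (by norm_num) (hcAtDim_of_hcUpToDim h)),
    fun h₄ ↦ hcUpToDim_seven_of_censusOff h𝒞 h₃ h₂ h₄ h₅⟩

omit h₄ in
/-- **Rows `≤ 7` from the cell `W₆` BY NAME** (stmt-2524, unrestricted), HC on `𝒞`, the census off `𝒞` and the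
floor. [cite: Markman2025SecantWeil, Thm. 1.5.1] [cite: MoonenZarhin1999LowDim, §5; arXiv:math/9901113] -/
theorem hcUpToDim_seven_of_censusOff_of_weilSixfolds (hW : Theses.SevenfoldWeilCensus.WeilSixfolds) :
    HCUpToDim 7 :=
  hcUpToDim_seven_of_censusOff h𝒞 h₃ h₂ (weilSixfoldsOff_of_weilSixfolds 𝒞 hW) h₅

omit h₄ in
/-- **EXACTNESS of the cell: modulo {HC on `𝒞`, census off `𝒞`, floor}, `HCUpToDim 7 ↔ WeilSixfolds`** — rows `6, 7`
carry ONE cell, `W₆` (stmt-2524). [cite: Markman2025SecantWeil, Thm. 1.5.1] [cite: MoonenZarhin1999LowDim, §5] -/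
theorem hcUpToDim_seven_iff_weilSixfolds_of_censusOff :
    HCUpToDim 7 ↔ Theses.SevenfoldWeilCensus.WeilSixfolds :=
  ⟨weilSixfolds_of_hcUpToDim_seven, hcUpToDim_seven_of_censusOff_of_weilSixfolds h𝒞 h₃ h₂ h₅⟩

omit h₄ in
/-- **Row `6` is EXACTLY the cell `W₆`**, modulo the same. [cite: Markman2025SecantWeil, Thm. 1.5.1] [cite: MoonenZarhin1999LowDim, §5] -/
theorem hcAtDim_six_iff_weilSixfolds_of_censusOff :
    HCAtDim 6 ↔ Theses.SevenfoldWeilCensus.WeilSixfolds :=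
  ⟨weilSixfolds_of_hcAtDim_six, fun hW ↦
    hcAtDim_mono (by norm_num) (hcAtDim_of_hcUpToDim (hcUpToDim_seven_of_censusOff_of_weilSixfolds h𝒞 h₃ h₂ h₅ hW))⟩

omit h₄ in
/-- **Row `7` has NO cell of its own: `HCUpToDim 7 ↔ HCAtDim 6`**, modulo {HC on `𝒞`, census off `𝒞`, floor}
(compare `Ring2ClassTargetsRows.hcUpToDim_five_iff_hcUpToDim_four`: row `5` collapses onto row `4` modulo
Moonen–Zarhin Thm. 0.2). [cite: MoonenZarhin1999LowDim, Thm. 0.2 and (2.7); arXiv:math/9901113] -/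
theorem hcUpToDim_seven_iff_hcAtDim_six_of_censusOff : HCUpToDim 7 ↔ HCAtDim 6 :=
  ⟨fun h ↦ hcAtDim_mono (by norm_num) (hcAtDim_of_hcUpToDim h),
    fun h6 ↦ hcUpToDim_seven_of_censusOff_of_weilSixfolds h𝒞 h₃ h₂ h₅ (weilSixfolds_of_hcAtDim_six h6)⟩

omit h₄ h₅ in
/-- **Rows `≤ 7` are EXACTLY the two Weil cells `W₄ ∧ W₆`**, modulo HC on `𝒞`, the census off `𝒞`, and the
refereed Moonen–Zarhin Thms. 0.1–0.2 (hypotheses `h01`, `h02`; the floor `HCUpToDim 5 ↔ W₄` is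
`Ring2ClassTargetsRows.hcUpToDim_five_iff_weilClassesFourfolds`). [cite: MoonenZarhin1999LowDim, Thms. 0.1, 0.2;
arXiv:math/9901113] [cite: Markman2025SecantWeil, Cor. 1.6.1 and Thm. 1.5.1] [cite: Schoen1988HodgeWeil, Thm.] -/
theorem hcUpToDim_seven_iff_weilCells_of_censusOff
    (h01 : MoonenZarhin1999_codimTwoHodgeClasses_abelianFourfold)
    (h02 : MoonenZarhin1999_codimTwoHodgeClasses_abelianFivefold) :
    HCUpToDim 7 ↔
      Markman2025_weilClasses_algebraic_abelianFourfold ∧ Theses.SevenfoldWeilCensus.WeilSixfolds :=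
  ⟨fun h ↦ ⟨weilClassesFourfolds_of_hcAtDim_four (hcAtDim_mono (by norm_num) (hcAtDim_of_hcUpToDim h)),
      weilSixfolds_of_hcUpToDim_seven h⟩,
    fun h ↦ hcUpToDim_seven_of_censusOff_of_weilSixfolds h𝒞 h₃ h₂
      ((hcUpToDim_five_iff_weilClassesFourfolds h01 h02).mpr h.1) h.2⟩

end CensusOff

/-! ## §S2 `𝒞 = IsOfCMType`: where `HC_CM` is load-bearing in rows `6, 7` -/

/-- **UNDER `HC_CM` (binder by name), rows `≤ 7` are EXACTLY the Weil classes of the NON-CM Weil-type sixfolds**,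
modulo the census OFF THE CM LOCUS (X2, X1 demanded only for non-CM six- and sevenfolds — every violator of the CM
census, `PohlmannSetsZeta24ProductSixfold`, is a product of CM abelian varieties, hence inside the hypothesis; the
non-CM candidate `Y × Z` of `Ring2AtlasSixfolds` is NOT, see `hcUpToDim_seven_iff_weilSixfoldsOff_of_hcCM_of_hcOnClass`)
and the floor `HCUpToDim 5` (`↔ W₄` modulo Moonen–Zarhin). `HC_CM` enters through `hcOnClass_cmType_of_hcCM` only.
[cite: Milne1999, §7 (H)] [cite: Deligne1982HodgeCycles, §5] [cite: GaoUllmo2025, Thm. 3.1]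
[cite: MoonenZarhin1999LowDim, §5; arXiv:math/9901113] [cite: Markman2025SecantWeil, Thm. 1.5.1] -/
theorem hcUpToDim_seven_iff_nonCMWeilSixfolds_of_hcCM (hCM : Theses.RankFourFaces.CMAbelianHodge)
    (h₃ : ∀ A : AbelianVariety ℂ, A.dim = 6 ∨ A.dim = 7 → ¬ IsOfCMType A → ∀ c : complexBetti A.X (2 * 2),
      IsRationalClass c → IsOfHodgeType A.dim A.X (2 * 2) 2 2 c →
        c ∈ divisorClassesSpan A.X A.dim 2 ⊔ Submodule.span ℂ {w' : complexBetti A.X (2 * 2) |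
          ∃ (C : AbelianVariety ℂ) (g : A.X ⟶ C.X) (w : complexBetti C.X (2 * 2)), C.dim < A.dim ∧
            IsRationalClass w ∧ IsOfHodgeType C.dim C.X (2 * 2) 2 2 w ∧ w' = complexBetti.map g (2 * 2) w})
    (h₂ : ∀ A : AbelianVariety ℂ, A.dim = 6 ∨ A.dim = 7 → ¬ IsOfCMType A → ∀ c : complexBetti A.X (2 * 3),
      IsRationalClass c → IsOfHodgeType A.dim A.X (2 * 3) 3 3 c →
        c ∈ divisorClassesSpan A.X A.dim 3 ⊔ Submodule.span ℂ {w' : complexBetti A.X (2 * 3) |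
            ∃ (a : complexBetti A.X (2 * 2)) (b : complexBetti A.X (2 * 1)),
              IsRationalClass a ∧ IsOfHodgeType A.dim A.X (2 * 2) 2 2 a ∧ IsRationalClass b ∧
              IsOfHodgeType A.dim A.X (2 * 1) 1 1 b ∧ w' = cupProduct (two_mul_add_two_mul 2 1) a b} ⊔
          Submodule.span ℂ {w' : complexBetti A.X (2 * 3) |
            ∃ (C : AbelianVariety ℂ) (g : A.X ⟶ C.X) (w : complexBetti C.X (2 * 3)), C.dim < A.dim ∧
              IsRationalClass w ∧ IsOfHodgeType C.dim C.X (2 * 3) 3 3 w ∧ w' = complexBetti.map g (2 * 3) w} ⊔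
          Submodule.span ℂ {w' : complexBetti A.X (2 * 3) |
            ∃ (B : AbelianVariety ℂ) (g : A.X ⟶ B.X) (d : ℕ) (ψ : B ⟶ B) (w : complexBetti B.X (2 * 3)),
              B.dim = 6 ∧ 0 < d ∧ ψ ≫ ψ = -(d • 𝟙 B) ∧ IsRationalClass w ∧
              IsOfHodgeType B.dim B.X (2 * 3) 3 3 w ∧ w ∈ weilClassesOf B ψ 3 d ∧
              w' = complexBetti.map g (2 * 3) w})
    (h₅ : HCUpToDim 5) :
    HCUpToDim 7 ↔
      ∀ (d : ℕ), 0 < d → ∀ (B : AbelianVariety ℂ) (ψ : B ⟶ B), B.dim = 6 → ψ ≫ ψ = -(d • 𝟙 B) →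
        ¬ IsOfCMType B → ∀ w : complexBetti B.X (2 * 3), IsRationalClass w →
          IsOfHodgeType B.dim B.X (2 * 3) 3 3 w → w ∈ weilClassesOf B ψ 3 d → w ∈ algebraicClasses B.X 3 :=
  hcUpToDim_seven_iff_weilSixfoldsOff_of_censusOff (hcOnClass_cmType_of_hcCM hCM) h₃ h₂ h₅

/-- **`HC_CM` plus any further granted cell `𝒦`** (hypothesis `HCOnClass 𝒦` — e.g. atlas-2's non-CM row
`Ring2.Atlas.HodgeQuarticTypeIVFourfoldTimesCMSurface`, or any class settled in print): rows `≤ 7` are EXACTLY the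
Weil classes of the Weil-type sixfolds outside `CM ∪ 𝒦`, modulo the census demanded only OFF `CM ∪ 𝒦` and the
floor (`hcOnClass_or_iff` joins the two granted cells). The honest shape of RING2-MAP (c7) after the X2 evidence:
the cells that must be GRANTED in rows `6, 7` are `CM` (by `HC_CM`) and every non-CM violator of the census.
[cite: Milne1999, §7 (H)] [cite: MoonenZarhin1999LowDim, §5; arXiv:math/9901113] [cite: Markman2025SecantWeil, Thm. 1.5.1] -/
theorem hcUpToDim_seven_iff_weilSixfoldsOff_of_hcCM_of_hcOnClass (hCM : Theses.RankFourFaces.CMAbelianHodge)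
    {𝒦 : AbelianVariety ℂ → Prop} (h𝒦 : HCOnClass 𝒦)
    (h₃ : ∀ A : AbelianVariety ℂ, A.dim = 6 ∨ A.dim = 7 → ¬ (IsOfCMType A ∨ 𝒦 A) →
      ∀ c : complexBetti A.X (2 * 2), IsRationalClass c → IsOfHodgeType A.dim A.X (2 * 2) 2 2 c →
        c ∈ divisorClassesSpan A.X A.dim 2 ⊔ Submodule.span ℂ {w' : complexBetti A.X (2 * 2) |
          ∃ (C : AbelianVariety ℂ) (g : A.X ⟶ C.X) (w : complexBetti C.X (2 * 2)), C.dim < A.dim ∧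
            IsRationalClass w ∧ IsOfHodgeType C.dim C.X (2 * 2) 2 2 w ∧ w' = complexBetti.map g (2 * 2) w})
    (h₂ : ∀ A : AbelianVariety ℂ, A.dim = 6 ∨ A.dim = 7 → ¬ (IsOfCMType A ∨ 𝒦 A) →
      ∀ c : complexBetti A.X (2 * 3), IsRationalClass c → IsOfHodgeType A.dim A.X (2 * 3) 3 3 c →
        c ∈ divisorClassesSpan A.X A.dim 3 ⊔ Submodule.span ℂ {w' : complexBetti A.X (2 * 3) |
            ∃ (a : complexBetti A.X (2 * 2)) (b : complexBetti A.X (2 * 1)),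
              IsRationalClass a ∧ IsOfHodgeType A.dim A.X (2 * 2) 2 2 a ∧ IsRationalClass b ∧
              IsOfHodgeType A.dim A.X (2 * 1) 1 1 b ∧ w' = cupProduct (two_mul_add_two_mul 2 1) a b} ⊔
          Submodule.span ℂ {w' : complexBetti A.X (2 * 3) |
            ∃ (C : AbelianVariety ℂ) (g : A.X ⟶ C.X) (w : complexBetti C.X (2 * 3)), C.dim < A.dim ∧
              IsRationalClass w ∧ IsOfHodgeType C.dim C.X (2 * 3) 3 3 w ∧ w' = complexBetti.map g (2 * 3) w} ⊔
          Submodule.span ℂ {w' : complexBetti A.X (2 * 3) |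
            ∃ (B : AbelianVariety ℂ) (g : A.X ⟶ B.X) (d : ℕ) (ψ : B ⟶ B) (w : complexBetti B.X (2 * 3)),
              B.dim = 6 ∧ 0 < d ∧ ψ ≫ ψ = -(d • 𝟙 B) ∧ IsRationalClass w ∧
              IsOfHodgeType B.dim B.X (2 * 3) 3 3 w ∧ w ∈ weilClassesOf B ψ 3 d ∧
              w' = complexBetti.map g (2 * 3) w})
    (h₅ : HCUpToDim 5) :
    HCUpToDim 7 ↔
      ∀ (d : ℕ), 0 < d → ∀ (B : AbelianVariety ℂ) (ψ : B ⟶ B), B.dim = 6 → ψ ≫ ψ = -(d • 𝟙 B) →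
        ¬ (IsOfCMType B ∨ 𝒦 B) → ∀ w : complexBetti B.X (2 * 3), IsRationalClass w →
          IsOfHodgeType B.dim B.X (2 * 3) 3 3 w → w ∈ weilClassesOf B ψ 3 d → w ∈ algebraicClasses B.X 3 :=
  hcUpToDim_seven_iff_weilSixfoldsOff_of_censusOff (𝒞 := fun A ↦ IsOfCMType A ∨ 𝒦 A)
    (hcOnClass_or_iff.mpr ⟨hcOnClass_cmType_of_hcCM hCM, h𝒦⟩) h₃ h₂ h₅

/-! ## §S3 Audit: the HC-shaped statements of this file are on-path -/

/-- Audit: rows `≤ 7`, row `6`, row `7`, the cell `W₆` and its restriction off any class follow from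
`HodgeConjecture` (on-path). The census hypotheses X2 / X1 (off `𝒞`) are NOT consequences of `HodgeConjecture`
and are never asserted in this file. [cite: Deligne2000, §1] -/
theorem rowsSixSeven_of_hodgeConjecture (h : _root_.HodgeConjecture) (𝒞 : AbelianVariety ℂ → Prop) :
    HCUpToDim 7 ∧ HCAtDim 6 ∧ HCAtDim 7 ∧ Theses.SevenfoldWeilCensus.WeilSixfolds ∧
      (∀ (d : ℕ), 0 < d → ∀ (B : AbelianVariety ℂ) (ψ : B ⟶ B), B.dim = 6 → ψ ≫ ψ = -(d • 𝟙 B) → ¬ 𝒞 B →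
        ∀ w : complexBetti B.X (2 * 3), IsRationalClass w → IsOfHodgeType B.dim B.X (2 * 3) 3 3 w →
          w ∈ weilClassesOf B ψ 3 d → w ∈ algebraicClasses B.X 3) :=
  ⟨hcOnClass_of_hodgeConjecture _ h, hcOnClass_of_hodgeConjecture _ h, hcOnClass_of_hodgeConjecture _ h,
    weilSixfolds_of_hcAtDim_six (hcOnClass_of_hodgeConjecture _ h),
    weilSixfoldsOff_of_hcAtDim_six 𝒞 (hcOnClass_of_hodgeConjecture _ h)⟩

end Summit.HodgeConjecture.HodgeConjecture.Ring2.ClassTargets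
end
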